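import Summits.MatrixMultiplication.MatrixMultiplication.Theorems.SoloInformedSchonhageAsymptotic
import Summits.MatrixMultiplication.MatrixMultiplication.Theorems.SoloInformedCwTwoShadow
import HarnessLib

/-!
# `4^{ω/3} ≤ R̃(T₂)`: the door tensor `T₂ = T(U₂)` and its door `R̃(T₂) = 3 ⇒ ω ≤ 2.3774`

Solo-informed seat (gen 30), paper §2q, part 3 of 3 (after `SoloInformedSchonhageAsymptotic.lean`;
independent of part 2 `SoloInformedTriangularDoor.lean`, whose `triangularTensor K 2` unfolds to the
tensor `T(U₂) = ⟨2,2,2⟩_{U₂,U₂}` written out here).  Everything here is PROVED.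

* **`k = 2` of the triangular family is the door tensor `T₂ = tTwo`** of gens 24–29 (the structure
  tensor of the upper triangular `2 × 2` matrices `U₂`, `SoloInformedTTwoSquare.lean`):
  `tTwo_eq_triangular_comp` / `triangular_two_eq_tTwo_comp` (the `U₂` table read on the pattern
  positions / padded by zero slices; restrictions both ways), `asymptoticRank_triangular_two`:
  `R̃(T(U₂)) = R̃(T₂)` over every field.
* `four_rpow_omega_div_three_le_asymptoticRank_tTwo` — **`4^{ω/3} ≤ R̃(T₂)`** over every infinite
  field (Schönhage, filling `4`); `omega_le_of_asymptoticRank_tTwo_le`: `R̃(T₂) ≤ ρ ⇒ ω ≤ 3 log₄ ρ`.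
* **The `T₂` door** `omega_le_of_asymptoticRank_tTwo_eq_three`: over `ℂ`,
  **`R̃(T₂) = 3 ⇒ ω ≤ 3 log₄ 3 = 2.37744`** (`omega_lt_of_asymptoticRank_tTwo_le_three`: `< 2.3775`;
  the record is `2.3713`).  This CORRECTS the seat's gen-24 note "`R̃(t₂) = 3` implies nothing about
  `ω`" and makes the gen-25 shadow `R̃(T_{cw,2}) ≤ 3 ⇒ R̃(T₂) = 3`
  (`asymptoticRank_tTwo_eq_three_of_door`) QUANTITATIVE: door D1 (`⇒ ω = 2`) implies the `T₂`-door
  hypothesis, which alone still gives `ω ≤ 2.3774` (`tTwo_door_of_cw_door`).  Known window: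
  `3 ≤ R̃(T₂) ≤ √14 < 3.742` (`three_le_asymptoticRank_tTwo`, `asymptoticRank_tTwo_le_sqrt_fourteen`);
  Schönhage's unconditional `4^{ω/3} ≥ 4^{2/3} = 2.52` is below the flattening `3`, and the record
  `2.3713` would need `R̃(T₂) < 4^{0.7905} = 2.99 < 3`: the `T₂` door can never beat the record, the
  first record-relevant rung of the family is `k = 3` (part 2).  NOT a door to `ω = 2` (paper level,
  §2q): `T₂` is binding, hence `111`-sharp, and not a unit tensor, so Theorem R of gen 20
  (`ReversibleUnit.irreversible_of_not_unit`) makes it irreversible, `Q̃(T₂) < R̃(T₂)`, and the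
  Christandl–Vrana–Zuiddam barrier excludes an `ω = 2` proof through `T₂` alone (numerically
  `Q̃(T₂) ≤ ζ^{(1/3,1/3,1/3)}(T₂) ≈ 2.86`, capping bounds via `T₂` near `2 log 3 / log 2.86 ≈ 2.09`).

## References

* [BurgisserClausenShokrollahi1997] P. Bürgisser, M. Clausen, M. A. Shokrollahi, *Algebraic
  Complexity Theory*, Springer 1997, §15.9: (15.46), Lemma (15.47), Thm. (15.48), Ex. (15.50)
  (pp. 407–410, held, read); Ex. 17.23(4) (`T₂`).
* [Schonhage1981] A. Schönhage, *Partial and total matrix multiplication*, SIAM J. Comput. 10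
  (1981) 434–455, Thm. 4.1.
* [AlmanDuanVassilevskaWilliamsXuXuZhou2025] J. Alman et al., SODA 2025 = arXiv:2404.16349, §3.4
  (`R̃(⟨q,q,q⟩) = q^ω`); the record `ω < 2.371339`.
* [ChristandlVranaZuiddam2023] M. Christandl, P. Vrana, J. Zuiddam, *Universal points in the
  asymptotic spectrum of tensors*, J. AMS 36 (2023), §1.1 (`R̃`), Example 1.4 (flattening ranks).
* [Blaser2013] M. Bläser, *Fast Matrix Multiplication*, ToC Graduate Surveys 5 (2013), Lemma 5.4,
  Lemma 7.1.
* [Alman2021] J. Alman, Theory of Computing 17 (2021), §2.4 (`R̃` is monotone under degeneration).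
* [CoppersmithWinograd1990] D. Coppersmith, S. Winograd, J. Symbolic Comput. 9 (1990), §11 (door D1).
-/

noncomputable section

open scoped BigOperators

namespace Summit.MatrixMultiplication.MatrixMultiplication.Theorems

open Literature.Computability.AlgebraicComplexity
open Literature.Barriers.MatrixMultiplication (asymptoticRank_le_of_polyDegeneratesTo
  asymptoticRank_rotate)

/-! ## `k = 2`: the door tensor `T₂ = T(U₂)` -/

/- NOTATION (no new definitions): `U₂` = the upper triangular pattern `{(i,j) : i ≤ j} ⊆ [2] × [2]`
(= `U₂` of part 2) and `TU₂[K]` = the partial matrix multiplication tensor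
`T(U₂) = ⟨2,2,2⟩_{U₂,U₂}` over `K` (= `triangularTensor K 2` of part 2, definitionally). -/
set_option quotPrecheck false in
local notation "U₂" => (Finset.univ.filter fun p : Fin 2 × Fin 2 => p.1 ≤ p.2)
set_option quotPrecheck false in
local notation "TU₂[" K "]" => (partialMatMulTensor K 2 2 2 U₂ U₂)

section TTwo

/-- The embedding of the basis `(E₀₀, E₀₁, E₁₁)` of `U₂` (indices `0, 1, 2` of `tTwo`) into the
positions `[2] × [2]`. [cite: BurgisserClausenShokrollahi1997, Ex. 17.23(4)] -/
def tTwoPos : Fin 3 → Fin 2 × Fin 2 := ![(0, 0), (0, 1), (1, 1)]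

/-- The retraction `[2] × [2] → Fin 3` (the non-pattern position `(1,0)` goes anywhere).
[cite: BurgisserClausenShokrollahi1997, Ex. 17.23(4)] -/
def tTwoIdx : Fin 2 × Fin 2 → Fin 3 := fun p => if p.1 = 0 then (if p.2 = 0 then 0 else 1) else 2

variable (K : Type*) [Field K]

/-- The `U₂` multiplication table on positions, as a decidable identity of integer tensors:
`T₂(a,b,c) = ⟨2,2,2⟩_{U,U}(pos c, pos a, pos b)`. [cite: BurgisserClausenShokrollahi1997, Ex. 17.23(4)] -/
private theorem tTwoInt_eq_indicator (a b c : Fin 3) : tTwoInt a b c =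
    if ((tTwoPos a ∈ U₂ ∧ tTwoPos b ∈ U₂) ∧
      ((tTwoPos c).1 = (tTwoPos a).1 ∧ (tTwoPos a).2 = (tTwoPos b).1 ∧
        (tTwoPos c).2 = (tTwoPos b).2)) then 1 else 0 := by
  revert a b c
  decide

/-- The padded table: `⟨2,2,2⟩_{U,U}(r, p, q) = [p ∈ U][q ∈ U][r ∈ U] · T₂(idx p, idx q, idx r)` as a
decidable identity of integer tensors. [cite: BurgisserClausenShokrollahi1997, Ex. 17.23(4)] -/
private theorem indicator_eq_tTwoInt (p q r : Fin 2 × Fin 2) :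
    (if ((p ∈ U₂ ∧ q ∈ U₂) ∧ (r.1 = p.1 ∧ p.2 = q.1 ∧ r.2 = q.2))
      then (1 : ℤ) else 0) =
    (if p ∈ U₂ then 1 else 0) * (if q ∈ U₂ then 1 else 0) *
      (if r ∈ U₂ then 1 else 0) * tTwoInt (tTwoIdx p) (tTwoIdx q) (tTwoIdx r) := by
  revert p q r
  decide

/-- **`T₂` is `T(U₂)` read on the pattern positions** (factor order: `T₂(x, y, z)` with `z = xy`,
`T(U₂)(z, x, y)`): `T₂(a,b,c) = T(U₂)(pos c, pos a, pos b)`. [cite: BurgisserClausenShokrollahi1997, Ex. 17.23(4)] -/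
theorem tTwo_eq_triangular_comp :
    tTwo K = fun a b c => rotate TU₂[K] (tTwoPos a) (tTwoPos b) (tTwoPos c) := by
  funext a b c
  rw [rotate_apply, partialMatMulTensor_apply]
  show ((tTwoInt a b c : ℤ) : K) = _
  rw [tTwoInt_eq_indicator]
  push_cast
  rfl

/-- Conversely **`T(U₂)` is `T₂` padded by zero slices**:
`T(U₂)(z,x,y) = [x ∈ U][y ∈ U][z ∈ U] · T₂(idx x, idx y, idx z)`. [cite: BurgisserClausenShokrollahi1997, Ex. 17.23(4)] -/
theorem triangular_two_eq_tTwo_comp :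
    rotate TU₂[K] = fun p q r =>
      (if p ∈ U₂ then (1 : K) else 0) * (if q ∈ U₂ then (1 : K) else 0) *
        (if r ∈ U₂ then (1 : K) else 0) * tTwo K (tTwoIdx p) (tTwoIdx q) (tTwoIdx r) := by
  funext p q r
  rw [rotate_apply, partialMatMulTensor_apply]
  have h := congrArg (Int.cast : ℤ → K) (indicator_eq_tTwoInt p q r)
  push_cast at h
  exact h

/-- Restriction along maps with `0/1` guards on all three legs. [cite: Blaser2013, Lemma 5.4] -/
theorem tensorRestrictsTo_precomp_guard {ι κ μ ι' κ' μ' : Type*} [Fintype ι] [Fintype κ]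
    [Fintype μ] [DecidableEq ι] [DecidableEq κ] [DecidableEq μ] (t : ι → κ → μ → K) (f : ι' → ι)
    (g : κ' → κ) (h : μ' → μ) (φ : ι' → K) (ψ : κ' → K) (χ : μ' → K) :
    TensorRestrictsTo t (fun a b c => φ a * ψ b * χ c * t (f a) (g b) (h c)) := by
  refine ⟨fun a' a => if f a' = a then φ a' else 0, fun b' b => if g b' = b then ψ b' else 0,
    fun c' c => if h c' = c then χ c' else 0, fun a' b' c' => ?_⟩
  rw [Finset.sum_eq_single (f a') (fun a _ ha => by simp [Ne.symm ha]) (by simp),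
    Finset.sum_eq_single (g b') (fun b _ hb => by simp [Ne.symm hb]) (by simp),
    Finset.sum_eq_single (h c') (fun c _ hc => by simp [Ne.symm hc]) (by simp)]
  simp

/-- `T(U₂)` (rotated) restricts to `T₂`. [cite: Blaser2013, Lemma 5.4] -/
theorem triangular_two_restrictsTo_tTwo :
    TensorRestrictsTo (rotate TU₂[K]) (tTwo K) := by
  classical
  rw [tTwo_eq_triangular_comp K]
  exact tensorRestrictsTo_precomp _ _ _ _

/-- `T₂` restricts to `T(U₂)` (rotated). [cite: Blaser2013, Lemma 5.4] -/
theorem tTwo_restrictsTo_triangular_two :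
    TensorRestrictsTo (tTwo K) (rotate TU₂[K]) := by
  classical
  rw [triangular_two_eq_tTwo_comp K]
  exact tensorRestrictsTo_precomp_guard K (tTwo K) tTwoIdx tTwoIdx tTwoIdx _ _ _

/-- **`R̃(T(U₂)) = R̃(T₂)`** over every field. [cite: Alman2021, §2.4] -/
theorem asymptoticRank_triangular_two (K : Type) [Field K] :
    asymptoticRank TU₂[K] = asymptoticRank (tTwo K) := by
  rw [← asymptoticRank_rotate TU₂[K]]
  exact le_antisymm
    (asymptoticRank_le_of_polyDegeneratesTo (tTwo_restrictsTo_triangular_two K).polyDegeneratesTo)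
    (asymptoticRank_le_of_polyDegeneratesTo (triangular_two_restrictsTo_tTwo K).polyDegeneratesTo)

/-- The filling of `U₂`: the `4` products `E₀₀E₀₀, E₀₀E₀₁, E₀₁E₁₁, E₁₁E₁₁` (`= filling_upperPattern_two`
of part 2). [cite: BurgisserClausenShokrollahi1997, Thm. (15.48)] -/
theorem filling_two_upper_eq_four : filling 2 2 2 U₂ U₂ = 4 := by
  decide

variable (K : Type) [Field K] [Infinite K]

/-- **Schönhage's bound for the door tensor: `4^{ω/3} ≤ R̃(T₂)`** over every infinite field
(`T₂ = ⟨2,2,2⟩_{U₂,U₂}`, filling `4`). [cite: BurgisserClausenShokrollahi1997, Thm. (15.48)] -/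
theorem four_rpow_omega_div_three_le_asymptoticRank_tTwo :
    (4 : ℝ) ^ (omega K / 3) ≤ asymptoticRank (tTwo K) := by
  have h := filling_rpow_le_asymptoticRank K 2 2 2 U₂ U₂
  rw [filling_two_upper_eq_four, asymptoticRank_triangular_two] at h
  exact_mod_cast h

/-- **The `T₂` door, general form: `R̃(T₂) ≤ ρ ⇒ ω ≤ 3 log₄ ρ`.**
[cite: BurgisserClausenShokrollahi1997, Thm. (15.48)] -/
theorem omega_le_of_asymptoticRank_tTwo_le {ρ : ℝ} (hρ : asymptoticRank (tTwo K) ≤ ρ) :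
    omega K ≤ 3 * Real.logb 4 ρ := by
  have h := omega_le_three_mul_logb_of_asymptoticRank_le K
    (show 2 ≤ filling 2 2 2 U₂ U₂ by rw [filling_two_upper_eq_four]; norm_num)
    ((asymptoticRank_triangular_two K).le.trans hρ)
  rw [filling_two_upper_eq_four] at h
  exact_mod_cast h

end TTwo

/-! ## Over `ℂ`: the shadow of door D1 is quantitative -/

section Complex

/-- **The `T₂` door: `R̃(T₂) = 3 ⇒ ω ≤ 3 log₄ 3 = 2.3774…`** (`3` is the flattening value,
`three_le_asymptoticRank_tTwo`; the current record is `ω < 2.3714`).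
[cite: BurgisserClausenShokrollahi1997, Thm. (15.48)] -/
theorem omega_le_of_asymptoticRank_tTwo_eq_three (h : asymptoticRank (tTwo ℂ) = 3) :
    omega ℂ ≤ 3 * Real.logb 4 3 :=
  omega_le_of_asymptoticRank_tTwo_le ℂ h.le

set_option exponentiation.threshold 500 in
/-- Numerically: **`R̃(T₂) ≤ 3 ⇒ ω < 2.3775`** (`4^{317/400} > 3`).
[cite: BurgisserClausenShokrollahi1997, Thm. (15.48)] -/
theorem omega_lt_of_asymptoticRank_tTwo_le_three (h : asymptoticRank (tTwo ℂ) ≤ 3) :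
    omega ℂ < 2.3775 := by
  have key := (four_rpow_omega_div_three_le_asymptoticRank_tTwo ℂ).trans h
  by_contra hω
  rw [not_lt] at hω
  have h1 : (4 : ℝ) ^ ((317 : ℝ) / 400) ≤ (4 : ℝ) ^ (omega ℂ / 3) :=
    Real.rpow_le_rpow_of_exponent_le (by norm_num) (by linarith)
  have h2 : ((4 : ℝ) ^ ((317 : ℝ) / 400)) ^ (400 : ℕ) = (4 : ℝ) ^ (317 : ℕ) := by
    rw [← Real.rpow_natCast, ← Real.rpow_mul (by norm_num)]
    norm_num
  have h3 : ((4 : ℝ) ^ ((317 : ℝ) / 400)) ^ (400 : ℕ) ≤ (3 : ℝ) ^ (400 : ℕ) :=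
    pow_le_pow_left₀ (by positivity) (h1.trans key) 400
  rw [h2] at h3
  norm_num at h3

/-- **Door D1 ⇒ the `T₂` door hypothesis** (`R̃(T_{cw,2}) ≤ 3 ⇒ R̃(T₂) = 3`, the gen-25 shadow),
so the `T₂` door is a WEAKER hypothesis with the weaker conclusion `ω ≤ 2.3774` (door D1 gives
`ω = 2`, `matrixMultiplication_of_asymptoticRank_cwTensor_two_le_three`).
[cite: CoppersmithWinograd1990, §11] -/
theorem tTwo_door_of_cw_door (h : asymptoticRank (cwTensor ℂ 2) ≤ 3) : omega ℂ < 2.3775 :=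
  omega_lt_of_asymptoticRank_tTwo_le_three (asymptoticRank_tTwo_eq_three_of_door h).le

end Complex

end Summit.MatrixMultiplication.MatrixMultiplication.Theorems

end
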